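import Literature.Analysis.SpecialFunctions.GegenbauerSupBound
import HarnessLib

/-!
# The Legendre generating function and the bound `|P_n| ≤ 1` on `[-1, 1]`

Topic `Literature/Analysis/SpecialFunctions`; namespace `Literature.Analysis.SpecialFunctions`.
The case `λ = 1/2` of the tree's Gegenbauer material (`GegenbauerBivariate`, `GegenbauerGenerating`,
`GegenbauerSupBound`): the Legendre polynomials `P_n = C_n^{(1/2)}` (`gegenbauerSum (1/2) n`) satisfy

* `gegenbauerSum_half_at_one` — `P_n(1) = 1` (from `(n+1) C_{n+1}(1) = (n + 2λ) C_n(1)` at `λ = 1/2`);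
* `abs_gegenbauerSum_half_le_one` — **`|P_n(s)| ≤ 1` for `|s| ≤ 1`** (AAR (6.4.11) / DLMF 18.14.4 via
  the tree's sharp bound `|C_n^{(a)}(s)| ≤ C_n^{(a)}(1)`);
* `gegenbauerHom_scale` — homogeneity `P^λ_j(rσ, r²π) = r^j P^λ_j(σ, π)` of the bivariate form;
* `hasSum_gegenbauerSum_mul_pow` — **the generating function on the closed interval**:
  `Σ_n C_n^{(λ)}(s) rⁿ = (1 − 2sr + r²)^{−λ}` for `λ ≥ 0`, `|s| ≤ 1`, `|r| < 1` (AAR (6.4.10)), in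
  particular `Σ_n P_n(s) rⁿ = (1 − 2sr + r²)^{−1/2}` (`hasSum_legendre_generating`).

These are the two analytic inputs of the Legendre-expansion locality estimate of
Hernández–Jansen–Lüscher for `(A†A)^{-1/2}` (`Literature.MathematicalPhysics.QuantumLattice.HJLLocality`).
Everything is proved; no definitions, no named facts.

## References
* G. E. Andrews, R. Askey, R. Roy, *Special Functions*, CUP 1999, §6.4, (6.4.10)–(6.4.11). [AndrewsAskeyRoy1999]
* NIST DLMF 18.14.4, 18.12.11.
-/

noncomputable section

open Finset
open scoped Nat

namespace Literature.Analysis.SpecialFunctions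

/-- `P_n(1) = 1`: the Legendre polynomials (`C_n^{(1/2)}`) take the value `1` at `1`. [cite: AndrewsAskeyRoy1999, §6.4 (C_n^λ(1) = (2λ)_n/n!)] -/
theorem gegenbauerSum_half_at_one (n : ℕ) : gegenbauerSum (1 / 2) n 1 = 1 := by
  induction n with
  | zero => simp
  | succ n ih =>
    have h := gegenbauerSum_at_one_rec (1 / 2) n
    rw [ih, show (n : ℝ) + 2 * (1 / 2) = (n : ℝ) + 1 by ring, mul_one] at h
    exact mul_left_cancel₀ (by positivity) (h.trans (mul_one _).symm)

/-- **`|P_n(s)| ≤ 1` on `[-1, 1]`** (DLMF 18.14.4 at `λ = 1/2`). [cite: AndrewsAskeyRoy1999, (6.4.11)] -/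
theorem abs_gegenbauerSum_half_le_one (n : ℕ) {s : ℝ} (hs : |s| ≤ 1) :
    |gegenbauerSum (1 / 2) n s| ≤ 1 :=
  (abs_gegenbauerSum_le_gegenbauerSum_one (by norm_num) n hs).trans_eq (gegenbauerSum_half_at_one n)

/-- **Homogeneity of the bivariate form**: `P^λ_j(rσ, r²π) = r^j P^λ_j(σ, π)` (the form is
weighted-homogeneous of degree `j` for `deg σ = 1`, `deg π = 2`). [folklore] -/
theorem gegenbauerHom_scale {A : Type*} [CommRing A] [Algebra ℝ A] (lam : ℝ) (j : ℕ) (r σ π : A) :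
    gegenbauerHom lam j (r * σ) (r ^ 2 * π) = r ^ j * gegenbauerHom lam j σ π := by
  unfold gegenbauerHom
  rw [Finset.mul_sum]
  refine Finset.sum_congr rfl fun x hx => ?_
  rw [mem_antidiagonal] at hx
  rcases le_or_gt x.1 x.2 with h | h
  · rw [mul_smul_comm]
    congr 1
    have : j = 2 * x.1 + (x.2 - x.1) := by omega
    rw [this]
    ring
  · rw [Nat.choose_eq_zero_of_lt h, Nat.cast_zero, mul_zero, zero_smul, zero_smul, mul_zero]

/-- **The Gegenbauer generating function on the closed interval**:
`Σ_n C_n^{(λ)}(s) rⁿ = (1 − 2sr + r²)^{−λ}` for `λ ≥ 0`, `|s| ≤ 1`, `|r| < 1`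
(the tree's `hasSum_gegenbauerHom` at `p = sr`, `q = r²`). [cite: AndrewsAskeyRoy1999, (6.4.10)] -/
theorem hasSum_gegenbauerSum_mul_pow {lam : ℝ} (hlam : 0 ≤ lam) {s r : ℝ} (hs : |s| ≤ 1)
    (hr : |r| < 1) :
    HasSum (fun n : ℕ => gegenbauerSum lam n s * r ^ n) ((1 - 2 * s * r + r ^ 2) ^ (-lam)) := by
  have hs2 : s ^ 2 ≤ 1 := by
    have := abs_le.mp hs
    nlinarith
  have hpq : (s * r) ^ 2 ≤ r ^ 2 := by
    rw [mul_pow]; nlinarith [sq_nonneg r]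
  have hq : r ^ 2 < 1 := by
    have := abs_lt.mp hr
    nlinarith
  have h := hasSum_gegenbauerHom hlam hpq hq
  have hfun : (fun n : ℕ => gegenbauerSum lam n s * r ^ n) =
      fun j : ℕ => gegenbauerHom lam j (2 * (s * r)) (r ^ 2) := by
    funext j
    have hsc := gegenbauerHom_scale lam j r (2 * s) (1 : ℝ)
    rw [mul_one] at hsc
    rw [gegenbauerSum_eq_gegenbauerHom, show 2 * (s * r) = r * (2 * s) by ring, hsc, mul_comm]
  rw [hfun, show 1 - 2 * s * r + r ^ 2 = 1 - 2 * (s * r) + r ^ 2 by ring]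
  exact h

/-- **The Legendre generating function**: `Σ_n P_n(s) rⁿ = (1 − 2sr + r²)^{−1/2}` for `|s| ≤ 1`,
`|r| < 1`. [cite: AndrewsAskeyRoy1999, (6.4.10)] -/
theorem hasSum_legendre_generating {s r : ℝ} (hs : |s| ≤ 1) (hr : |r| < 1) :
    HasSum (fun n : ℕ => gegenbauerSum (1 / 2) n s * r ^ n)
      ((1 - 2 * s * r + r ^ 2) ^ (-(1 / 2 : ℝ))) :=
  hasSum_gegenbauerSum_mul_pow (by norm_num) hs hr

end Literature.Analysis.SpecialFunctions

end
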